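import Summits.NavierStokesRegularity.NavierStokesRegularity.Theorems.LerayQuarterDissipationFiniteDissipationLiouvilleQuietSlice
import Literature.Analysis.FluidPDE.BarkerPrange2020VorticityAlignmentTypeIHolds
import HarnessLib

/-!
# Crux `FiniteDissipationLiouville` (stmt-NavierStokesRegularity-22144): the QUIET-CORE leaves —
# a finite-dissipation Type-I profile which, at ONE instant, is small (or has small dissipation)
# on ONE parabolic core ball is regular at the apex

Theorems file of route `LerayQuarterDissipation` (seat ns-lqd-p2 g7; `--supports` the crux; the
"QuietCore" converter banked by the route's planner ns-idea-3 g3, and its dissipation twin).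
Navier–Stokes regularity is NOT proved by anything here; no summit is.

`𝒟_{C,K}`: Type-I ancient mild fields `w` (KNSS gauge, `IsTypeIAncientMild C w`) with the law
`∫ ‖∇w(s)‖² ≤ K/√(−s)`, `s < 0`. The quiet-slice leaf (`QuietSlice.quietSlice_leaf`, p606065) needs
ONE instant of small GLOBAL dissipation; here smallness is asked only on ONE CORE BALL
`B(0, r√(−t))` of ANY fixed similarity radius `r > 0`, at one instant, in two currencies:

* `quietCoreAmplitude_leaf` — `∀ C K r > 0, ∃ δ > 0`: scaled amplitude `√(−t)‖w(t,x)‖ ≤ δ` on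
  `B(0, r√(−t))` at one `t < 0` ⇒ `w` bounded on some backward cylinder at the origin;
* `quietCoreDissipation_leaf` — same with core dissipation `∫_{B(0, r√(−t))} ‖∇w(t)‖² ≤ δ/√(−t)`;
* `coreAmplitude_floor_of_singular`, `coreDissipation_floor_of_singular` — contrapositives: **a
  SINGULAR member of the stratum is nowhere-in-time quiet at the core: at every instant `t < 0` and
  every similarity radius `r`, some point of `B(0, r√(−t))` has scaled amplitude `> δ(C,K,r)` and
  the core ball has dissipation `> δ(C,K,r)/√(−t)`.**

Mechanism (new input: SPATIAL ANALYTICITY of slices, `IsTypeIAncientMild.analyticOnNhd_slice_univ`,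
Lemarié-Rieusset 2016 Thm 9.12): scale the instant to `−1`; along a putative sequence of singular
counterexamples with `δ = 1/(k+1)`, KNSS compactness across members (`Compactness.seqLimit`) gives a
singular limit member (`persistent_singularity_seq`) whose slice `−1` vanishes on `B(0,r)` (pointwise
limit), resp. has zero dissipation there (Fatou on the ball) hence zero gradient on the open ball;
the identity theorem spreads this to `ℝ³`; a slice with vanishing gradient is zero
(`QuietSlice.slice_eq_zero_of_lintegral_fderiv_sq_eq_zero`); forward uniqueness from the zero slice
(`CalmSlice.not_singular_of_zero_slice`) contradicts the singularity. HONEST FRAMING: `δ(C,K,r)` is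
by compactness, not explicit; no DSS scenario is removed from the crux's wall (portrait facts only).

References: Koch–Nadirashvili–Seregin–Šverák, Acta Math. 203 (2009) = arXiv:0709.3599, §4;
Lemarié-Rieusset, *The Navier–Stokes problem in the 21st century* (2016), Thm 9.12;
Albritton–Barker, arXiv:1811.00502, Prop. 2.3.
-/

noncomputable section

-- the summit and its single sub-problem share the name (CONVENTIONS §1), as in every Theorems file
set_option linter.dupNamespace false

namespace Summit.NavierStokesRegularity.NavierStokesRegularity.Theorems.FiniteDissipationLiouville.QuietCore

open MeasureTheory Set Filter Topology Metric Function
open Literature.Analysis Literature.Analysis.FluidPDE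
open Summit.NavierStokesRegularity.NavierStokesRegularity.Theorems.FiniteDissipationLiouville
open scoped ENNReal NNReal

/-! ### Tools: Fatou on a set, scaling of the core dissipation -/
/-- **Fatou along the gradients on a set, eventual bounds** (set version of
`Subthreshold.lintegral_fderiv_sq_le_of_tendsto_of_eventually`). -/
theorem setLIntegral_fderiv_sq_le_of_tendsto_of_eventually {S : Set (EuclideanSpace ℝ (Fin 3))}
    {w : ℕ → EuclideanSpace ℝ (Fin 3) → EuclideanSpace ℝ (Fin 3)}
    {W : EuclideanSpace ℝ (Fin 3) → EuclideanSpace ℝ (Fin 3)} {B : ℝ≥0∞}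
    (hconv : ∀ x, Tendsto (fun k => fderiv ℝ (w k) x) atTop (𝓝 (fderiv ℝ W x)))
    (hlaw : ∀ᶠ k in atTop, ∫⁻ x in S, ‖fderiv ℝ (w k) x‖ₑ ^ 2 ≤ B) :
    ∫⁻ x in S, ‖fderiv ℝ W x‖ₑ ^ 2 ≤ B := by
  have hpt : ∀ x, Tendsto (fun k => ‖fderiv ℝ (w k) x‖ₑ ^ 2) atTop (𝓝 (‖fderiv ℝ W x‖ₑ ^ 2)) :=
    fun x => ((ENNReal.continuous_pow 2).tendsto _).comp ((continuous_enorm.tendsto _).comp (hconv x))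
  have e : (fun x => ‖fderiv ℝ W x‖ₑ ^ 2) = fun x => liminf (fun k => ‖fderiv ℝ (w k) x‖ₑ ^ 2) atTop :=
    funext fun x => ((hpt x).liminf_eq).symm
  have hmeas : ∀ k, AEMeasurable (fun x => ‖fderiv ℝ (w k) x‖ₑ ^ 2) (volume.restrict S) := fun k =>
    ((measurable_fderiv ℝ (w k)).enorm.pow_const 2).aemeasurable
  calc ∫⁻ x in S, ‖fderiv ℝ W x‖ₑ ^ 2
      = ∫⁻ x in S, liminf (fun k => ‖fderiv ℝ (w k) x‖ₑ ^ 2) atTop := by rw [e]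
    _ ≤ liminf (fun k => ∫⁻ x in S, ‖fderiv ℝ (w k) x‖ₑ ^ 2) atTop := lintegral_liminf_le' hmeas
    _ ≤ B := liminf_le_of_frequently_le' (hlaw.frequently)

/-- **Scaling of the core dissipation**: `∫_{B(0,r)} ‖∇w_c(s)‖² = c ∫_{B(0,c r)} ‖∇w(c²s)‖²`,
`w_c(s,x) = c w(c²s, cx)`, `c > 0` (chain rule and the substitution `y = cx`). [cite: KochNadirashviliSereginSverak2009, §1 (1.2) (arXiv:0709.3599 p. 2)] -/
theorem setLIntegral_ball_fderiv_nsRescale_sq {c : ℝ} (hc : 0 < c)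
    (u : ℝ → EuclideanSpace ℝ (Fin 3) → EuclideanSpace ℝ (Fin 3)) (s r : ℝ) :
    ∫⁻ x in ball (0 : EuclideanSpace ℝ (Fin 3)) r, ‖fderiv ℝ (nsRescale c u s) x‖ₑ ^ 2 =
      ENNReal.ofReal c *
        ∫⁻ y in ball (0 : EuclideanSpace ℝ (Fin 3)) (c * r), ‖fderiv ℝ (u (c ^ 2 * s)) y‖ₑ ^ 2 := by
  have hc0 : c ≠ 0 := hc.ne'
  set G : EuclideanSpace ℝ (Fin 3) → ℝ≥0∞ :=
    (ball (0 : EuclideanSpace ℝ (Fin 3)) (c * r)).indicator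
      fun y => ‖fderiv ℝ (u (c ^ 2 * s)) y‖ₑ ^ 2 with hG
  have e1 : ∀ x, (ball (0 : EuclideanSpace ℝ (Fin 3)) r).indicator
      (fun x => ‖fderiv ℝ (nsRescale c u s) x‖ₑ ^ 2) x = ENNReal.ofReal (c ^ 4) * G (c • x + 0) := by
    intro x
    rw [add_zero]
    by_cases hx : x ∈ ball (0 : EuclideanSpace ℝ (Fin 3)) r
    · have hcx : c • x ∈ ball (0 : EuclideanSpace ℝ (Fin 3)) (c * r) := by
        rw [mem_ball_zero_iff] at hx ⊢
        rw [norm_smul, Real.norm_of_nonneg hc.le]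
        exact mul_lt_mul_of_pos_left hx hc
      rw [indicator_of_mem hx, hG, indicator_of_mem hcx, RecurrentReductionD.fderiv_nsRescale,
        enorm_smul, mul_pow]
      congr 1
      rw [Real.enorm_eq_ofReal (by positivity), ← ENNReal.ofReal_pow (by positivity)]
      congr 1
      ring
    · have hcx : c • x ∉ ball (0 : EuclideanSpace ℝ (Fin 3)) (c * r) := by
        rw [mem_ball_zero_iff] at hx ⊢
        rw [norm_smul, Real.norm_of_nonneg hc.le]
        intro h
        exact hx (lt_of_mul_lt_mul_left h hc.le)
      rw [indicator_of_notMem hx, hG, indicator_of_notMem hcx, mul_zero]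
  have hL : ∫⁻ x in ball (0 : EuclideanSpace ℝ (Fin 3)) r, ‖fderiv ℝ (nsRescale c u s) x‖ₑ ^ 2 =
      ∫⁻ x, (ball (0 : EuclideanSpace ℝ (Fin 3)) r).indicator
        (fun x => ‖fderiv ℝ (nsRescale c u s) x‖ₑ ^ 2) x :=
    (lintegral_indicator measurableSet_ball _).symm
  have hR : ∫⁻ y in ball (0 : EuclideanSpace ℝ (Fin 3)) (c * r), ‖fderiv ℝ (u (c ^ 2 * s)) y‖ₑ ^ 2 =
      ∫⁻ y, G y := by
    rw [hG]; exact (lintegral_indicator measurableSet_ball _).symm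
  rw [hL, hR]
  simp_rw [e1]
  rw [lintegral_const_mul' _ _ ENNReal.ofReal_ne_top, PoincareBall.lintegral_comp_smul_add G hc0 0,
    ← mul_assoc, finrank_euclideanSpace, Fintype.card_fin]
  congr 1
  rw [← ENNReal.ofReal_mul (by positivity)]
  congr 1
  rw [abs_of_pos (by positivity)]
  field_simp

/-! ### Analyticity: quiet cores spread to the whole slice -/

/-- **A slice of a member of the class vanishing on a ball vanishes identically** (the slice is
real-analytic on `ℝ³`, `IsTypeIAncientMild.analyticOnNhd_slice_univ`; identity theorem). [cite: LemarieRieusset2016, Thm. 9.12 (PDF p. 260)] -/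
theorem slice_eq_zero_of_eq_zero_on_ball {C : ℝ}
    {w : ℝ → EuclideanSpace ℝ (Fin 3) → EuclideanSpace ℝ (Fin 3)}
    (hw : IsTypeIAncientMild C w) {s : ℝ} (hs : s < 0) {r : ℝ} (hr : 0 < r)
    (h0 : ∀ x ∈ ball (0 : EuclideanSpace ℝ (Fin 3)) r, w s x = 0) : ∀ x, w s x = 0 := by
  have han : AnalyticOnNhd ℝ (w s) univ := hw.analyticOnNhd_slice_univ hs
  have hev : w s =ᶠ[𝓝 (0 : EuclideanSpace ℝ (Fin 3))] fun _ => (0 : EuclideanSpace ℝ (Fin 3)) :=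
    eventuallyEq_of_mem (ball_mem_nhds 0 hr) fun x hx => h0 x hx
  have heq : w s = fun _ => (0 : EuclideanSpace ℝ (Fin 3)) :=
    funext fun x => AnalyticOnNhd.eqOn_of_preconnected_of_eventuallyEq han analyticOnNhd_const
      (convex_univ.isPreconnected) (mem_univ 0) hev (mem_univ x)
  exact fun x => congrFun heq x

/-- **A slice of a member of `𝒟_{C,K}` with vanishing gradient on a ball vanishes identically**
(the gradient is analytic: identity theorem; then `QuietSlice.slice_eq_zero_of_lintegral_fderiv_sq_eq_zero`). [cite: LemarieRieusset2016, Thm. 9.12 (PDF p. 260)] -/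
theorem slice_eq_zero_of_fderiv_eq_zero_on_ball {C K : ℝ}
    {w : ℝ → EuclideanSpace ℝ (Fin 3) → EuclideanSpace ℝ (Fin 3)}
    (hw : IsTypeIAncientMild C w)
    (hlaw : ∀ s : ℝ, s < 0 →
      ∫⁻ x, ‖fderiv ℝ (w s) x‖ₑ ^ 2 ≤ ENNReal.ofReal (K / Real.sqrt (-s)))
    {s : ℝ} (hs : s < 0) {r : ℝ} (hr : 0 < r)
    (h0 : ∀ x ∈ ball (0 : EuclideanSpace ℝ (Fin 3)) r,
      fderiv ℝ (w s) x = (0 : EuclideanSpace ℝ (Fin 3) →L[ℝ] EuclideanSpace ℝ (Fin 3))) :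
    ∀ x, w s x = 0 := by
  have han : AnalyticOnNhd ℝ (w s) univ := hw.analyticOnNhd_slice_univ hs
  have hanF : AnalyticOnNhd ℝ (fderiv ℝ (w s)) univ := han.fderiv
  have hev : fderiv ℝ (w s) =ᶠ[𝓝 (0 : EuclideanSpace ℝ (Fin 3))]
      fun _ => (0 : EuclideanSpace ℝ (Fin 3) →L[ℝ] EuclideanSpace ℝ (Fin 3)) :=
    eventuallyEq_of_mem (ball_mem_nhds 0 hr) fun x hx => h0 x hx
  have hF0 : ∀ x, fderiv ℝ (w s) x = 0 := fun x =>
    AnalyticOnNhd.eqOn_of_preconnected_of_eventuallyEq hanF analyticOnNhd_const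
      (convex_univ.isPreconnected) (mem_univ 0) hev (mem_univ x)
  have hzero : ∫⁻ x, ‖fderiv ℝ (w s) x‖ₑ ^ 2 = 0 := by
    have e : (fun x => ‖fderiv ℝ (w s) x‖ₑ ^ 2) = fun _ => (0 : ℝ≥0∞) := by
      funext x
      rw [hF0 x, enorm_eq_nnnorm, nnnorm_zero, ENNReal.coe_zero, zero_pow two_ne_zero]
    rw [e, lintegral_zero]
  exact QuietSlice.slice_eq_zero_of_lintegral_fderiv_sq_eq_zero hw hlaw hs hzero

/-! ### The compactness cores -/
/-- **No sequence of singular members of `𝒟_{C,K}` has asymptotically vanishing slices at `t = −1`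
on a fixed ball** (compactness, persistence, analyticity, forward uniqueness). [cite: KochNadirashviliSereginSverak2009, §4 (arXiv:0709.3599 p. 8)] -/
theorem false_of_quietCoreAmplitude_seq {C K r : ℝ} (hr : 0 < r)
    {w : ℕ → ℝ → EuclideanSpace ℝ (Fin 3) → EuclideanSpace ℝ (Fin 3)}
    (hwk : ∀ k, IsTypeIAncientMild C (w k))
    (hlaw : ∀ k, ∀ s : ℝ, s < 0 →
      ∫⁻ x, ‖fderiv ℝ (w k s) x‖ₑ ^ 2 ≤ ENNReal.ofReal (K / Real.sqrt (-s)))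
    (hsing : ∀ k, ∀ ρ > 0, ∀ M : ℝ, ∃ t ∈ Ioo (-(ρ ^ 2)) (0 : ℝ),
      ∃ x ∈ ball (0 : EuclideanSpace ℝ (Fin 3)) ρ, M < ‖w k t x‖)
    (hsmall : ∀ k, ∀ x ∈ ball (0 : EuclideanSpace ℝ (Fin 3)) r,
      ‖w k (-1) x‖ ≤ 1 / ((k : ℝ) + 1)) :
    False := by
  obtain ⟨ψ, hψ, W, hW, hunif, hpt, -⟩ := Compactness.seqLimit hwk
  have hψt : Tendsto ψ atTop atTop := hψ.tendsto_atTop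
  have hWsing := Compactness.persistent_singularity_seq (w := fun j => w (ψ j))
    (fun j => hwk (ψ j)) (fun j => hlaw (ψ j)) (fun j => hsing (ψ j)) hW hunif
  -- the limit slice vanishes on the ball
  have hball : ∀ x ∈ ball (0 : EuclideanSpace ℝ (Fin 3)) r, W (-1) x = 0 := by
    intro x hx
    have h1 : Tendsto (fun j => w (ψ j) (-1) x) atTop (𝓝 (W (-1) x)) := hpt (-1) (by norm_num) x
    have hb : Tendsto (fun j => 1 / ((ψ j : ℝ) + 1)) atTop (𝓝 0) :=
      (tendsto_one_div_add_atTop_nhds_zero_nat (𝕜 := ℝ)).comp hψt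
    have h2 : Tendsto (fun j => w (ψ j) (-1) x) atTop (𝓝 0) :=
      squeeze_zero_norm (fun j => hsmall (ψ j) x hx) hb
    exact tendsto_nhds_unique h1 h2
  have hslice : ∀ x, W (-1) x = 0 :=
    slice_eq_zero_of_eq_zero_on_ball hW (by norm_num) hr hball
  exact CalmSlice.not_singular_of_zero_slice hW (by norm_num : (-1 : ℝ) < 0) hslice hWsing

/-- **No sequence of singular members of `𝒟_{C,K}` has asymptotically vanishing core dissipation
at `t = −1` on a fixed ball** (Fatou on the ball, continuity, analyticity, forward uniqueness). [cite: KochNadirashviliSereginSverak2009, §4 (arXiv:0709.3599 p. 8)] -/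
theorem false_of_quietCoreDissipation_seq {C K r : ℝ} (hr : 0 < r)
    {w : ℕ → ℝ → EuclideanSpace ℝ (Fin 3) → EuclideanSpace ℝ (Fin 3)}
    (hwk : ∀ k, IsTypeIAncientMild C (w k))
    (hlaw : ∀ k, ∀ s : ℝ, s < 0 →
      ∫⁻ x, ‖fderiv ℝ (w k s) x‖ₑ ^ 2 ≤ ENNReal.ofReal (K / Real.sqrt (-s)))
    (hsing : ∀ k, ∀ ρ > 0, ∀ M : ℝ, ∃ t ∈ Ioo (-(ρ ^ 2)) (0 : ℝ),
      ∃ x ∈ ball (0 : EuclideanSpace ℝ (Fin 3)) ρ, M < ‖w k t x‖)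
    (hquiet : ∀ k, ∫⁻ x in ball (0 : EuclideanSpace ℝ (Fin 3)) r, ‖fderiv ℝ (w k (-1)) x‖ₑ ^ 2 ≤
      ENNReal.ofReal (1 / ((k : ℝ) + 1))) :
    False := by
  obtain ⟨ψ, hψ, W, hW, hunif, -, hgrad⟩ := Compactness.seqLimit hwk
  have hψt : Tendsto ψ atTop atTop := hψ.tendsto_atTop
  have hWlaw : ∀ s : ℝ, s < 0 →
      ∫⁻ x, ‖fderiv ℝ (W s) x‖ₑ ^ 2 ≤ ENNReal.ofReal (K / Real.sqrt (-s)) :=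
    Compactness.law_of_seqLimit (Kinf := K) (Kk := fun _ => K) hψt hlaw
      (fun ε hε => Eventually.of_forall fun _ => by linarith) hgrad
  have hWsing := Compactness.persistent_singularity_seq (w := fun j => w (ψ j))
    (fun j => hwk (ψ j)) (fun j => hlaw (ψ j)) (fun j => hsing (ψ j)) hW hunif
  -- Fatou on the ball: zero core dissipation of the limit slice
  have hzero : ∫⁻ x in ball (0 : EuclideanSpace ℝ (Fin 3)) r, ‖fderiv ℝ (W (-1)) x‖ₑ ^ 2 = 0 := by
    refine le_antisymm (ENNReal.le_of_forall_pos_le_add fun ε hε _ => ?_) bot_le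
    rw [zero_add, ← ENNReal.ofReal_coe_nnreal]
    refine setLIntegral_fderiv_sq_le_of_tendsto_of_eventually (hgrad (-1) (by norm_num)) ?_
    have hεpos : (0 : ℝ) < ε := by exact_mod_cast hε
    obtain ⟨N, hN⟩ := exists_nat_gt (1 / (ε : ℝ))
    filter_upwards [hψt.eventually_ge_atTop N] with j hj
    refine (hquiet (ψ j)).trans (ENNReal.ofReal_le_ofReal ?_)
    have h1 : (N : ℝ) ≤ (ψ j : ℝ) := by exact_mod_cast hj
    have h2 : 1 / (ε : ℝ) < (ψ j : ℝ) + 1 := by linarith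
    rw [div_le_iff₀ (by positivity)]
    have := (div_lt_iff₀ hεpos).1 h2
    linarith
  -- the gradient vanishes a.e. on the ball, hence on the ball (continuity)
  have hmeas : AEMeasurable (fun x => ‖fderiv ℝ (W (-1)) x‖ₑ ^ 2)
      (volume.restrict (ball (0 : EuclideanSpace ℝ (Fin 3)) r)) :=
    ((measurable_fderiv ℝ (W (-1))).enorm.pow_const 2).aemeasurable
  have hae : ∀ᵐ x ∂(volume.restrict (ball (0 : EuclideanSpace ℝ (Fin 3)) r)),
      ‖fderiv ℝ (W (-1)) x‖ₑ ^ 2 = 0 := (lintegral_eq_zero_iff' hmeas).1 hzero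
  have hae' : fderiv ℝ (W (-1)) =ᵐ[volume.restrict (ball (0 : EuclideanSpace ℝ (Fin 3)) r)]
      fun _ => (0 : EuclideanSpace ℝ (Fin 3) →L[ℝ] EuclideanSpace ℝ (Fin 3)) := by
    filter_upwards [hae] with x hx
    have h1 : ‖fderiv ℝ (W (-1)) x‖ₑ = 0 := (pow_eq_zero_iff two_ne_zero).mp hx
    rwa [enorm_eq_nnnorm, ENNReal.coe_eq_zero, nnnorm_eq_zero] at h1
  have hcontF : Continuous (fderiv ℝ (W (-1))) :=
    (hW.contDiff_slice (by norm_num)).continuous_fderiv (by simp)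
  have hball : ∀ x ∈ ball (0 : EuclideanSpace ℝ (Fin 3)) r,
      fderiv ℝ (W (-1)) x = (0 : EuclideanSpace ℝ (Fin 3) →L[ℝ] EuclideanSpace ℝ (Fin 3)) :=
    fun x hx => Measure.eqOn_open_of_ae_eq hae' isOpen_ball hcontF.continuousOn continuousOn_const hx
  have hslice : ∀ x, W (-1) x = 0 :=
    slice_eq_zero_of_fderiv_eq_zero_on_ball hW hWlaw (by norm_num) hr hball
  exact CalmSlice.not_singular_of_zero_slice hW (by norm_num : (-1 : ℝ) < 0) hslice hWsing

/-! ### The leaves and their contrapositives -/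
/-- **Quiet-core leaf, amplitude form**: `∀ C K r > 0, ∃ δ > 0`, a member of `𝒟_{C,K}` with
`√(−t)‖w(t,x)‖ ≤ δ` on `B(0, r√(−t))` at ONE instant `t < 0` is bounded on a backward cylinder at
the origin (scale the instant to `−1`, then `false_of_quietCoreAmplitude_seq`). [cite: KochNadirashviliSereginSverak2009, §4 (arXiv:0709.3599 p. 8); LemarieRieusset2016, Thm. 9.12] -/
theorem quietCoreAmplitude_leaf : ∀ (C K r : ℝ), 0 < r → ∃ δ > 0,
    ∀ (w : ℝ → EuclideanSpace ℝ (Fin 3) → EuclideanSpace ℝ (Fin 3)),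
      IsTypeIAncientMild C w →
      (∀ s : ℝ, s < 0 → ∫⁻ x, ‖fderiv ℝ (w s) x‖ₑ ^ 2 ≤ ENNReal.ofReal (K / Real.sqrt (-s))) →
      (∃ t < 0, ∀ x ∈ ball (0 : EuclideanSpace ℝ (Fin 3)) (r * Real.sqrt (-t)),
        Real.sqrt (-t) * ‖w t x‖ ≤ δ) →
      ¬ (∀ ρ > 0, ∀ M : ℝ, ∃ t ∈ Ioo (-(ρ ^ 2)) (0 : ℝ),
        ∃ x ∈ ball (0 : EuclideanSpace ℝ (Fin 3)) ρ, M < ‖w t x‖) := by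
  intro C K r hr
  by_contra hcon
  push Not at hcon
  choose w' hw' hlaw' hq' hsing' using hcon
  choose t' ht' hq' using hq'
  have hpos : ∀ k : ℕ, (0 : ℝ) < 1 / ((k : ℝ) + 1) := fun k => by positivity
  set w : ℕ → ℝ → EuclideanSpace ℝ (Fin 3) → EuclideanSpace ℝ (Fin 3) :=
    fun k => w' _ (hpos k) with hw_def
  have hw : ∀ k, IsTypeIAncientMild C (w k) := fun k => hw' _ (hpos k)
  have hlaw := fun k => hlaw' _ (hpos k)
  have hsing := fun k => hsing' _ (hpos k)
  set t : ℕ → ℝ := fun k => t' _ (hpos k) with ht_def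
  have ht : ∀ k, t k < 0 := fun k => ht' _ (hpos k)
  have hq := fun k => hq' _ (hpos k)
  set c : ℕ → ℝ := fun k => Real.sqrt (-t k) with hc_def
  have hc : ∀ k, 0 < c k := fun k => Real.sqrt_pos.2 (neg_pos.2 (ht k))
  set v : ℕ → ℝ → EuclideanSpace ℝ (Fin 3) → EuclideanSpace ℝ (Fin 3) :=
    fun k => nsRescale (c k) (w k) with hv_def
  have hv : ∀ k, IsTypeIAncientMild C (v k) := fun k => isTypeIAncientMild_nsRescale (hw k) (hc k)
  have hvlaw : ∀ k, ∀ s : ℝ, s < 0 →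
      ∫⁻ x, ‖fderiv ℝ (v k s) x‖ₑ ^ 2 ≤ ENNReal.ofReal (K / Real.sqrt (-s)) :=
    fun k => RecurrentReductionD.dissipationLaw_nsRescale (hlaw k) (hc k)
  have hvsing : ∀ k, ∀ ρ > 0, ∀ M : ℝ, ∃ t ∈ Ioo (-(ρ ^ 2)) (0 : ℝ),
      ∃ x ∈ ball (0 : EuclideanSpace ℝ (Fin 3)) ρ, M < ‖v k t x‖ :=
    fun k => RecurrentReductionD.singularAtOrigin_nsRescale (hsing k) (hc k)
  have hvsmall : ∀ k, ∀ x ∈ ball (0 : EuclideanSpace ℝ (Fin 3)) r,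
      ‖v k (-1) x‖ ≤ 1 / ((k : ℝ) + 1) := by
    intro k x hx
    have e : c k ^ 2 * (-1 : ℝ) = t k := by
      rw [hc_def]; dsimp only; rw [Real.sq_sqrt (neg_nonneg.2 (ht k).le)]; ring
    have hcx : c k • x ∈ ball (0 : EuclideanSpace ℝ (Fin 3)) (r * Real.sqrt (-t k)) := by
      rw [mem_ball_zero_iff] at hx ⊢
      rw [norm_smul, Real.norm_of_nonneg (hc k).le, hc_def]
      dsimp only
      rw [mul_comm r]
      exact mul_lt_mul_of_pos_left hx (hc k)
    have h1 := hq k (c k • x) hcx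
    rw [hv_def]
    dsimp only
    rw [nsRescale_apply, e, norm_smul, Real.norm_of_nonneg (hc k).le]
    exact h1
  exact false_of_quietCoreAmplitude_seq hr hv hvlaw hvsing hvsmall

/-- **Quiet-core leaf, dissipation form**: `∀ C K r > 0, ∃ δ > 0`, a member of `𝒟_{C,K}` with
`∫_{B(0, r√(−t))} ‖∇w(t)‖² ≤ δ/√(−t)` at ONE instant `t < 0` is bounded on a backward cylinder at the
origin (scale to `−1` by `setLIntegral_ball_fderiv_nsRescale_sq`, then `false_of_quietCoreDissipation_seq`). [cite: KochNadirashviliSereginSverak2009, §4 (arXiv:0709.3599 p. 8); LemarieRieusset2016, Thm. 9.12] -/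
theorem quietCoreDissipation_leaf : ∀ (C K r : ℝ), 0 < r → ∃ δ > 0,
    ∀ (w : ℝ → EuclideanSpace ℝ (Fin 3) → EuclideanSpace ℝ (Fin 3)),
      IsTypeIAncientMild C w →
      (∀ s : ℝ, s < 0 → ∫⁻ x, ‖fderiv ℝ (w s) x‖ₑ ^ 2 ≤ ENNReal.ofReal (K / Real.sqrt (-s))) →
      (∃ t < 0, ∫⁻ x in ball (0 : EuclideanSpace ℝ (Fin 3)) (r * Real.sqrt (-t)),
        ‖fderiv ℝ (w t) x‖ₑ ^ 2 ≤ ENNReal.ofReal (δ / Real.sqrt (-t))) →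
      ¬ (∀ ρ > 0, ∀ M : ℝ, ∃ t ∈ Ioo (-(ρ ^ 2)) (0 : ℝ),
        ∃ x ∈ ball (0 : EuclideanSpace ℝ (Fin 3)) ρ, M < ‖w t x‖) := by
  intro C K r hr
  by_contra hcon
  push Not at hcon
  choose w' hw' hlaw' hq' hsing' using hcon
  choose t' ht' hq' using hq'
  have hpos : ∀ k : ℕ, (0 : ℝ) < 1 / ((k : ℝ) + 1) := fun k => by positivity
  set w : ℕ → ℝ → EuclideanSpace ℝ (Fin 3) → EuclideanSpace ℝ (Fin 3) :=
    fun k => w' _ (hpos k) with hw_def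
  have hw : ∀ k, IsTypeIAncientMild C (w k) := fun k => hw' _ (hpos k)
  have hlaw := fun k => hlaw' _ (hpos k)
  have hsing := fun k => hsing' _ (hpos k)
  set t : ℕ → ℝ := fun k => t' _ (hpos k) with ht_def
  have ht : ∀ k, t k < 0 := fun k => ht' _ (hpos k)
  have hq := fun k => hq' _ (hpos k)
  set c : ℕ → ℝ := fun k => Real.sqrt (-t k) with hc_def
  have hc : ∀ k, 0 < c k := fun k => Real.sqrt_pos.2 (neg_pos.2 (ht k))
  set v : ℕ → ℝ → EuclideanSpace ℝ (Fin 3) → EuclideanSpace ℝ (Fin 3) :=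
    fun k => nsRescale (c k) (w k) with hv_def
  have hv : ∀ k, IsTypeIAncientMild C (v k) := fun k => isTypeIAncientMild_nsRescale (hw k) (hc k)
  have hvlaw : ∀ k, ∀ s : ℝ, s < 0 →
      ∫⁻ x, ‖fderiv ℝ (v k s) x‖ₑ ^ 2 ≤ ENNReal.ofReal (K / Real.sqrt (-s)) :=
    fun k => RecurrentReductionD.dissipationLaw_nsRescale (hlaw k) (hc k)
  have hvsing : ∀ k, ∀ ρ > 0, ∀ M : ℝ, ∃ t ∈ Ioo (-(ρ ^ 2)) (0 : ℝ),
      ∃ x ∈ ball (0 : EuclideanSpace ℝ (Fin 3)) ρ, M < ‖v k t x‖ :=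
    fun k => RecurrentReductionD.singularAtOrigin_nsRescale (hsing k) (hc k)
  have hvquiet : ∀ k, ∫⁻ x in ball (0 : EuclideanSpace ℝ (Fin 3)) r, ‖fderiv ℝ (v k (-1)) x‖ₑ ^ 2 ≤
      ENNReal.ofReal (1 / ((k : ℝ) + 1)) := by
    intro k
    have e : c k ^ 2 * (-1 : ℝ) = t k := by
      rw [hc_def]; dsimp only; rw [Real.sq_sqrt (neg_nonneg.2 (ht k).le)]; ring
    have er : c k * r = r * Real.sqrt (-t k) := by rw [hc_def, mul_comm]
    rw [hv_def]
    dsimp only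
    rw [setLIntegral_ball_fderiv_nsRescale_sq (hc k), e, er]
    calc ENNReal.ofReal (c k) * ∫⁻ y in ball (0 : EuclideanSpace ℝ (Fin 3)) (r * Real.sqrt (-t k)),
          ‖fderiv ℝ (w k (t k)) y‖ₑ ^ 2
        ≤ ENNReal.ofReal (c k) * ENNReal.ofReal ((1 / ((k : ℝ) + 1)) / Real.sqrt (-t k)) := by
          gcongr
          exact hq k
      _ = ENNReal.ofReal (1 / ((k : ℝ) + 1)) := by
          rw [← ENNReal.ofReal_mul (hc k).le]
          congr 1
          rw [hc_def]
          dsimp only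
          rw [mul_div_assoc', mul_div_cancel_left₀ _ (hc k).ne']
  exact false_of_quietCoreDissipation_seq hr hv hvlaw hvsing hvquiet

/-- **Core amplitude floor**: a SINGULAR member of `𝒟_{C,K}` has, at EVERY instant `t < 0`, a point
`x ∈ B(0, r√(−t))` with `δ(C,K,r) < √(−t)‖w(t,x)‖` (contrapositive of `quietCoreAmplitude_leaf`). [cite: KochNadirashviliSereginSverak2009, §4 (arXiv:0709.3599 p. 8)] -/
theorem coreAmplitude_floor_of_singular : ∀ (C K r : ℝ), 0 < r → ∃ δ > 0,
    ∀ (w : ℝ → EuclideanSpace ℝ (Fin 3) → EuclideanSpace ℝ (Fin 3)),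
      IsTypeIAncientMild C w →
      (∀ s : ℝ, s < 0 → ∫⁻ x, ‖fderiv ℝ (w s) x‖ₑ ^ 2 ≤ ENNReal.ofReal (K / Real.sqrt (-s))) →
      (∀ ρ > 0, ∀ M : ℝ, ∃ t ∈ Ioo (-(ρ ^ 2)) (0 : ℝ),
        ∃ x ∈ ball (0 : EuclideanSpace ℝ (Fin 3)) ρ, M < ‖w t x‖) →
      ∀ t < 0, ∃ x ∈ ball (0 : EuclideanSpace ℝ (Fin 3)) (r * Real.sqrt (-t)),
        δ < Real.sqrt (-t) * ‖w t x‖ := by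
  intro C K r hr
  obtain ⟨δ, hδ, h⟩ := quietCoreAmplitude_leaf C K r hr
  refine ⟨δ, hδ, fun w hw hlaw hsing t ht => ?_⟩
  by_contra hle
  push Not at hle
  exact h w hw hlaw ⟨t, ht, hle⟩ hsing

/-- **Core dissipation floor**: a SINGULAR member of `𝒟_{C,K}` has, at EVERY instant `t < 0`,
`δ(C,K,r)/√(−t) < ∫_{B(0, r√(−t))} ‖∇w(t)‖²` (contrapositive of `quietCoreDissipation_leaf`). [cite: KochNadirashviliSereginSverak2009, §4 (arXiv:0709.3599 p. 8)] -/
theorem coreDissipation_floor_of_singular : ∀ (C K r : ℝ), 0 < r → ∃ δ > 0,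
    ∀ (w : ℝ → EuclideanSpace ℝ (Fin 3) → EuclideanSpace ℝ (Fin 3)),
      IsTypeIAncientMild C w →
      (∀ s : ℝ, s < 0 → ∫⁻ x, ‖fderiv ℝ (w s) x‖ₑ ^ 2 ≤ ENNReal.ofReal (K / Real.sqrt (-s))) →
      (∀ ρ > 0, ∀ M : ℝ, ∃ t ∈ Ioo (-(ρ ^ 2)) (0 : ℝ),
        ∃ x ∈ ball (0 : EuclideanSpace ℝ (Fin 3)) ρ, M < ‖w t x‖) →
      ∀ t < 0, ENNReal.ofReal (δ / Real.sqrt (-t)) <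
        ∫⁻ x in ball (0 : EuclideanSpace ℝ (Fin 3)) (r * Real.sqrt (-t)), ‖fderiv ℝ (w t) x‖ₑ ^ 2 := by
  intro C K r hr
  obtain ⟨δ, hδ, h⟩ := quietCoreDissipation_leaf C K r hr
  refine ⟨δ, hδ, fun w hw hlaw hsing t ht => ?_⟩
  by_contra hle
  push Not at hle
  exact h w hw hlaw ⟨t, ht, hle⟩ hsing

end Summit.NavierStokesRegularity.NavierStokesRegularity.Theorems.FiniteDissipationLiouville.QuietCore

end
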